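import Literature.MathematicalPhysics.QuantumLattice.ApproximatingHamiltonianProofs
import HarnessLib

/-!
# Koma–Tasaki 1993, Theorem 2.1 and Corollary 2.2: at every temperature the spontaneous
# (staggered) magnetisation dominates the long-range order — Griffiths' theorem for order
# operators that do NOT commute with the Hamiltonian (STATEMENTS; elementary steps proved)

T. Koma, H. Tasaki, *Symmetry breaking in Heisenberg antiferromagnets*, Commun. Math. Phys. **158**
(1993) 191–214 (`KomaTasaki1993`, held as `paper:doi-10-1007-bf02097237`; read at pp. 195–206),
§2 "Notation and Main Results", Theorem 2.1 (eq. (2.13)) and Corollary 2.2 (eq. (2.18)); proof in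
§§3–5 (coarse graining in energy space, Griffiths' argument [Griffiths, Phys. Rev. 152 (1966) 240],
completion) and §6 (Theorem 6.1, consequence of the `SU(2)` symmetry).  Seat `hubbard-cq-lit-1`
(cell `pub/hubbard-cq`, row "type KLS 1988 / Koma–Tasaki 1992/93/94 statements with exact
hypotheses incl. the `h → 0⁺` / volume-limit order"); companion files
`KaplanHorschVonDerLindenFieldBound.lean` / `KaplanHorschVonDerLindenMatrix.lean` (KT93 §7, ground
states, PROVED) and `KomaTasakiSSB*.lean` (KT94, PROVED).

## The printed setting (KT93 §2, pp. 195–196) and its rendering here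

A quantum system on a finite lattice `Λ` with `N` sites, finite-dimensional Hilbert space
`⊗_{x∈Λ} 𝓗_x` (2.1), Hamiltonian `H_Λ = Σ_x h_x` (2.2) with self-adjoint `h_x`, a unitary `U_Λ`
with `U_Λ H_Λ U_Λ* = H_Λ` (2.3), an order operator `O_Λ = Σ_x o_x` (2.4) with self-adjoint `o_x`
and `U_Λ O_Λ U_Λ* = -O_Λ` (2.5); under a field `B ∈ ℝ`, `H_Λ(B) = H_Λ - B O_Λ` (2.6),
`Z_Λ(B) = Tr e^{-β H_Λ(B)}` (2.7), `f_Λ(B) = -(β N)⁻¹ log Z_Λ(B)` (2.8),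
`⟨·⟩_Λ(B) = Tr[· e^{-βH_Λ(B)}]/Z_Λ(B)` (2.9), `β > 0`.  For a sequence of finite lattices
`Λ ↑ ℤ^d` (van Hove) one assumes
* i)   the thermodynamic limit `f(B) = lim_Λ f_Λ(B)` exists for the fixed `β > 0` and every
       `B ∈ ℝ` (2.10);
* ii)  `‖h_x‖ ≤ h̄`, `‖o_x‖ ≤ ō` with constants independent of `Λ`;
* iii) `[h_x, o_y] = 0` unless `y ∈ S(x)`, `|S(x)| ≤ r`, `r ≥ 2` independent of `Λ`;
and defines `m_s := lim_{B↓0} lim_{Λ↑ℤ^d} N⁻¹ ⟨O_Λ⟩_Λ(B)` (2.11) — VOLUME FIRST, FIELD SECOND — and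
`σ := lim_Λ (N⁻² ⟨(O_Λ)²⟩_Λ(0))^{1/2}` (2.12) ("the limit may not exist in general, but one can
always take a subsequence so that it exists").

**Theorem 2.1** (p. 197). *For an arbitrary sequence of models satisfying i), ii), iii),*
`m_s ≥ lim_Λ (N^{-2k} ⟨(O_Λ)^{2k}⟩_Λ(0))^{1/(2k)} ≥ σ` (2.13) *for any inverse temperature `β`
and any positive integer `k`.*  "The first bound in (2.13) will be proved in Sects. 3, 4 and 5.
The second bound is an immediate consequence of the Hölder inequality."

**Corollary 2.2** (p. 197). With three-component order operators `O_Λ^{(i)} = Σ_x o_x^{(i)}` (2.14)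
satisfying ii), iii) for each `i`, iv) `[o_x^{(i)}, o_y^{(j)}] = 0` for `x ≠ y`, `su(2)` generators
`X_Λ^{(1,2,3)}` with `[X^{(j)}, X^{(k)}] = i Σ_l ε_{jkl} X^{(l)}` (2.15), v)
`[X^{(j)}, O^{(k)}] = i Σ_l ε_{jkl} O^{(l)}` (2.16), vi) `[H_Λ, X^{(j)}] = 0` (2.17):
*for an arbitrary sequence of models satisfying i)–vi),* `m_s ≥ √3 σ` (2.18) *for any `β`*
("follows from Theorem 2.1 and Theorem 6.1"; for the Heisenberg antiferromagnet this is
Corollary 1.1, `m_s ≥ √3 σ`, (1.10)).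

Rendering (tree vocabulary, no new notions): the Hilbert space is `n → ℂ` for a finite nonempty
index type `n` and all operators are `Matrix n n ℂ` (the tensor-product structure of (2.1) is not
used by the statements or the proof beyond ii), iii)); sites are `Fin N`; the Gibbs state and
partition function are the tree's `Matrix.gibbsState β H`, `Matrix.partitionFn β H`
(`FinDimSpectrum.lean`); operator norms are Mathlib's `L2`-operator norm
(`Matrix.Norms.L2Operator`).  The data and hypotheses ii), iii), (2.3), (2.5) of ONE finite system
form the structure `Z2System N hb ob r n` (named in parallel with the tree's `KomaTasaki.U1System`
of KT94 §2.3: here the symmetry enters only through one unitary `U_Λ` flipping the sign of `O_Λ`;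
no group structure is assumed); the `SU(2)` data i)–vi) of Corollary 2.2 form `SU2System`.  A
sequence of models is `sys : (j : ℕ) → Z2System (N j) hb ob r (n j)` with `N j → ∞` (every van
Hove sequence has `|Λ| → ∞`; nothing else of the lattice geometry enters Theorem 2.1 — van Hove
regularity is only what makes hypothesis i) plausible, and i) is assumed).

## ORDER OF LIMITS and the exact content of (2.13) (what the printed proof establishes)

KT's proof (§4 (4.5)–(4.7), (4.20)–(4.24), §5 (5.1)–(5.3)) runs through
`m* := -lim_{B↓0} (f(B) - f(0))/B` (4.5) (exists by concavity of `f`) and shows, using i):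
(a) for every `m > m*`, `N^{-2k}⟨O^{2k}⟩_Λ(0) ≤ m^{2k} + 2ō^{2k} e^{-βNδ} e^{βh̄√N} + 2rk4^k ō^{2k} N^{-1/4}`
for all sufficiently large `N` (5.3), hence `limsup_Λ (N^{-2k}⟨O^{2k}⟩_Λ(0))^{1/(2k)} ≤ m*`; and
(b) `f_Λ(0) ≤ f_Λ(B) + B · N⁻¹⟨O_Λ⟩_Λ(B)` at finite volume (4.6) (concavity; PROVED below as
`Z2System.freeEnergy_zero_le`), hence by i) `liminf_Λ N⁻¹⟨O_Λ⟩_Λ(B) ≥ (f(0) - f(B))/B ≥ m*` for EVERY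
`B > 0` (the chord slope of the concave `f` is monotone, (4.21)), and `m* ≤ m_s` (4.7).
So the theorem AS PROVED reads: for every `k ≥ 1` and every `B > 0`,

  `limsup_{Λ} (N^{-2k} ⟨(O_Λ)^{2k}⟩_Λ(0))^{1/(2k)} ≤ liminf_{Λ} N⁻¹ ⟨O_Λ⟩_Λ(B)`,      (2.13′)

volume limits along the FULL sequence on both sides (this is where hypothesis i) is spent: without
i) only a common-subsequence comparison survives), and the field limit `B ↓ 0` of (2.11) is then
free (the right side is non-decreasing in `B` at finite volume, `d/dB ⟨O⟩_Λ(B) = β·Var ≥ 0`, tree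
`hasDerivAt_re_gibbsState_source`).  (2.13′) implies the printed (2.13) under every reading of the
printed `lim`'s, and is implied by the printed proof; it is the form typed below
(`kt93_theorem_2_1`, in `ε`–`j₀` language so that no `Filter.liminf` side conditions are needed),
and likewise for (2.18) (`kt93_corollary_2_2`).  NO finite-`(B, N)` inequality is printed for
`β < ∞` ((5.3) carries the unspecified "sufficiently large `N`" of Proposition 4.1, which comes from
i) via (4.22)–(4.23)); contrast the ground-state case KT93 (7.10), PROVED in finite form in
`KaplanHorschVonDerLindenFieldBound.lean`.  Direction: long-range order of the symmetric Gibbs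
states ⟹ order parameter under the symmetry-breaking field (LRO ⟹ response); the converse is not
asserted (cf. `Literature.Barriers.HubbardSuperconductivity.SourcedOrderWithoutGroundStateLRO`).

## What this file declares

* DEFINITIONS (with bodies): `Z2System` (KT93 §2 data + ii), iii), (2.3), (2.5)), its
  `hamiltonian` (2.2), `order` (2.4), `fieldHamiltonian` (2.6), `freeEnergy` (2.8),
  `magnetisation` (`N⁻¹⟨O_Λ⟩_Λ(B)`, the quantity under the limits in (2.11)), `moment`
  (`N^{-2k}⟨O_Λ^{2k}⟩_Λ(0)`, the quantity under the limit in (2.12)–(2.13)); `leviCivita`;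
  `SU2System` (i)–vi) of Corollary 2.2) with `SU2System.toZ2System`.
* PROVED: hermiticity of `H_Λ`, `O_Λ`, `H_Λ(B)`; the a-priori bounds `|N⁻¹⟨O⟩_Λ(B)| ≤ ō`,
  `0 ≤ N^{-2k}⟨O^{2k}⟩_Λ(0) ≤ ō^{2k}` (so both sides of (2.13′) are finite); KT93 (4.6)
  `f_Λ(0) ≤ f_Λ(B) + B N⁻¹⟨O_Λ⟩_Λ(B)` (`Z2System.freeEnergy_zero_le`, from the tree's
  Peierls–Bogoliubov inequality `log_partitionFn_sub_le_log_partitionFn_add`); the SECOND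
  inequality of (2.13) at finite volume, `(N⁻²⟨O²⟩_Λ(0))^k ≤ N^{-2k}⟨O^{2k}⟩_Λ(0)`
  (`Z2System.moment_one_pow_le`, root form `Z2System.sqrt_moment_one_le`), from the general
  Jensen inequality in a Gibbs state `(Re⟨Q⟩_β)^k ≤ Re⟨Q^k⟩_β` for `Q ⪰ 0`
  (`pow_re_gibbsState_le_re_gibbsState_pow`, spectral theorem + power means); and, FROM the named
  fact `kt93_theorem_2_1`, the consumable contrapositive "no spontaneous magnetisation ⟹ no
  long-range order" (`sqrt_moment_eventually_le_of_magnetisation_eventually_le`, the glue cited by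
  `HeisenbergOrder.mermin_wagner*`).
* NAMED FACTS (statements as printed, hypotheses complete, not proved here — the proof is KT93
  §§3–5, the energy-space coarse graining Lemma 3.1 / Proposition 3.2 / Lemma 3.3 and the modified
  Griffiths argument Proposition 4.1; SIZE L): `kt93_theorem_2_1` [cite: KomaTasaki1993, Thm 2.1]
  and `kt93_corollary_2_2` [cite: KomaTasaki1993, Cor 2.2].

## Mathlib / tree search

`lean search 'gibbsState|partitionFn|log_partitionFn|KomaTasaki1993|mermin_wagner'`: the tree has
`Matrix.gibbsState`, `Matrix.partitionFn`, `partitionFn_re_pos`, `abs_re_gibbsState_le`,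
`gibbsState_nonneg_of_posSemidef`, `log_partitionFn_sub_le_log_partitionFn_add` (Peierls–Bogoliubov),
`hasDerivAt_re_gibbsState_source` (all reused); KT93 Thm 2.1 / Cor 2.2 were so far only CITED inside
the docstrings of `HeisenbergOrder.mermin_wagner{,_staggered,_general}` (as the glue from the
magnetisation form of Mermin–Wagner to `¬ HasTorusLRO`) — no standalone declaration; this file is
that Literature parent.  Mathlib: `isSelfAdjoint_sum`, `Matrix.posSemidef_conjTranspose_mul_self`,
`norm_sum_le`, `norm_pow_le'`.  presearch (corpus hybrid "Koma Tasaki Griffiths theorem spontaneous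
magnetization long range order positive temperature coarse graining", galaxy
"Koma and Tasaki|Horsch and von der Linden"): the statement and full proof are held
(`paper:doi-10-1007-bf02097237` pp. 197–206); no secondary source restates or re-proves the
positive-temperature theorem (Friedli–Velenik 2017, Ruelle 1969, Lieb–Nachtergaele selecta =
the commuting / classical Griffiths theorem; Landsman 2017 §10 notes cite KT93 without statement).
-/

noncomputable section

open scoped Matrix.Norms.L2Operator ComplexOrder Topology
open Matrix Filter Finset

namespace Literature.MathematicalPhysics.QuantumLattice.KomaTasaki

universe v

/-! ### KT93 §2: one finite system with a sign-flipping symmetry -/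

/-- **KT93 §2, the data and volume-wise hypotheses of one finite system** ((2.1)–(2.5), ii), iii)).
A quantum system with `N` sites (`Fin N`) on the finite-dimensional Hilbert space `n → ℂ`: local
Hamiltonians `h_x` and order-operator densities `o_x` (self-adjoint matrices), a unitary `U_Λ` with
`U_Λ H_Λ U_Λ* = H_Λ` (2.3) and `U_Λ O_Λ U_Λ* = -O_Λ` (2.5) for `H_Λ = Σ_x h_x` (2.2),
`O_Λ = Σ_x o_x` (2.4); ii) `‖h_x‖ ≤ h̄ = hb`, `‖o_x‖ ≤ ō = ob`; iii) `[h_x, o_y] = 0` unless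
`y ∈ S(x) = supp x`, `|S(x)| ≤ r`, `r ≥ 2`.  The constants `hb ob r` are parameters (KT: "independent
of `Λ`"), so that a sequence of models with uniform constants is a dependent family
`(j : ℕ) → Z2System (N j) hb ob r (n j)` ("we do not assume that `h_x` and `o_x` are common for
different `Λ`").  Name: the symmetry enters only as one unitary acting on `O_Λ` as the sign flip
(the non-trivial element of `ℤ₂`); compare the tree's `KomaTasaki.U1System` (KT94 §2.3).
[cite: KomaTasaki1993, §2 (2.1)–(2.5) and hypotheses ii), iii) (p. 196)] -/
structure Z2System (N : ℕ) (hb ob : ℝ) (r : ℕ) (n : Type v) [Fintype n] [DecidableEq n] where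
  /-- local Hamiltonians `h_x` (2.2) -/
  h : Fin N → Matrix n n ℂ
  /-- order-operator densities `o_x` (2.4) -/
  o : Fin N → Matrix n n ℂ
  /-- the unitary `U_Λ` of (2.3), (2.5) -/
  U : Matrix n n ℂ
  /-- the support sets `S(x)` of iii) -/
  supp : Fin N → Finset (Fin N)
  /-- `h_x` self-adjoint -/
  isHermitian_h : ∀ x, (h x).IsHermitian
  /-- `o_x` self-adjoint -/
  isHermitian_o : ∀ x, (o x).IsHermitian
  /-- `U_Λ` unitary -/
  U_mul_conjTranspose : U * Uᴴ = 1
  /-- (2.3) `U_Λ H_Λ U_Λ* = H_Λ` -/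
  conj_hamiltonian : U * (∑ x, h x) * Uᴴ = ∑ x, h x
  /-- (2.5) `U_Λ O_Λ U_Λ* = -O_Λ` -/
  conj_order : U * (∑ x, o x) * Uᴴ = -∑ x, o x
  /-- ii) `‖h_x‖ ≤ h̄` -/
  norm_h_le : ∀ x, ‖h x‖ ≤ hb
  /-- ii) `‖o_x‖ ≤ ō` -/
  norm_o_le : ∀ x, ‖o x‖ ≤ ob
  /-- iii) `[h_x, o_y] = 0` unless `y ∈ S(x)` -/
  commute_h_o : ∀ x y, y ∉ supp x → Commute (h x) (o y)
  /-- iii) `|S(x)| ≤ r` -/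
  card_supp_le : ∀ x, (supp x).card ≤ r
  /-- iii) `r ≥ 2` -/
  two_le_r : 2 ≤ r

namespace Z2System

variable {N : ℕ} {hb ob : ℝ} {r : ℕ} {n : Type v} [Fintype n] [DecidableEq n]
variable (sys : Z2System N hb ob r n)

/-- `H_Λ = Σ_x h_x`. [cite: KomaTasaki1993, (2.2)] -/
def hamiltonian : Matrix n n ℂ := ∑ x, sys.h x

/-- `O_Λ = Σ_x o_x`. [cite: KomaTasaki1993, (2.4)] -/
def order : Matrix n n ℂ := ∑ x, sys.o x

/-- The Hamiltonian under the symmetry-breaking field `B`: `H_Λ(B) = H_Λ - B O_Λ`.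
[cite: KomaTasaki1993, (2.6)] -/
def fieldHamiltonian (B : ℝ) : Matrix n n ℂ := sys.hamiltonian - (B : ℂ) • sys.order

/-- The free energy per site `f_Λ(B) = -(β N)⁻¹ log Z_Λ(B)`, `Z_Λ(B) = Tr e^{-β H_Λ(B)}` (the tree's
`Matrix.partitionFn`, real and positive for Hermitian `H_Λ(B)`, `partitionFn_re_pos`).  Junk value
`0` for `N = 0` or `β = 0` (`(0 : ℝ)⁻¹ = 0`). [cite: KomaTasaki1993, (2.7)–(2.8)] -/
def freeEnergy (β B : ℝ) : ℝ :=
  -(β * N)⁻¹ * Real.log (partitionFn β (sys.fieldHamiltonian B)).re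

/-- The order parameter per site under the field, `m_Λ(B) = N⁻¹ ⟨O_Λ⟩_Λ(B)` with
`⟨·⟩_Λ(B)` the Gibbs state of `H_Λ(B)` at inverse temperature `β` (2.9); the spontaneous (staggered)
magnetisation (2.11) is `m_s = lim_{B↓0} lim_Λ m_Λ(B)`.  Junk value `0` for `N = 0`.
[cite: KomaTasaki1993, (2.9), (2.11)] -/
def magnetisation (β B : ℝ) : ℝ :=
  (N : ℝ)⁻¹ * (gibbsState β (sys.fieldHamiltonian B) sys.order).re

/-- The zero-field `2k`-th moment per site, `N^{-2k} ⟨(O_Λ)^{2k}⟩_Λ(0)`: the long-range order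
parameter (2.12) is `σ = lim_Λ (moment β 1)^{1/2}` and the middle term of (2.13) is
`lim_Λ (moment β k)^{1/(2k)}`. [cite: KomaTasaki1993, (2.12)–(2.13)] -/
def moment (β : ℝ) (k : ℕ) : ℝ :=
  ((N : ℝ) ^ (2 * k))⁻¹ * (gibbsState β sys.hamiltonian (sys.order ^ (2 * k))).re

/-- `H_Λ(0) = H_Λ`. [cite: KomaTasaki1993, (2.6)] -/
@[simp]
theorem fieldHamiltonian_zero : sys.fieldHamiltonian 0 = sys.hamiltonian := by
  simp [fieldHamiltonian]

/-- `H_Λ` is Hermitian. [cite: KomaTasaki1993, (2.2)] -/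
theorem isHermitian_hamiltonian : sys.hamiltonian.IsHermitian :=
  (isSelfAdjoint_sum Finset.univ fun x _ => (sys.isHermitian_h x).isSelfAdjoint).isHermitian

/-- `O_Λ` is Hermitian. [cite: KomaTasaki1993, (2.4)] -/
theorem isHermitian_order : sys.order.IsHermitian :=
  (isSelfAdjoint_sum Finset.univ fun x _ => (sys.isHermitian_o x).isSelfAdjoint).isHermitian

/-- `H_Λ(B)` is Hermitian for real `B`. [cite: KomaTasaki1993, (2.6)] -/
theorem isHermitian_fieldHamiltonian (B : ℝ) : (sys.fieldHamiltonian B).IsHermitian :=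
  isHermitian_sub_smul sys.isHermitian_hamiltonian sys.isHermitian_order B

/-- `B O_Λ` is Hermitian for real `B` (the field term of (2.6)). [cite: KomaTasaki1993, (2.6)] -/
theorem isHermitian_smul_order (B : ℝ) : ((B : ℂ) • sys.order).IsHermitian := by
  rw [IsHermitian, conjTranspose_smul, sys.isHermitian_order.eq]
  simp

/-- `H_Λ(B) + B O_Λ = H_Λ`. [cite: KomaTasaki1993, (2.6)] -/
theorem fieldHamiltonian_add_smul (B : ℝ) :
    sys.fieldHamiltonian B + (B : ℂ) • sys.order = sys.hamiltonian := by
  simp [fieldHamiltonian]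

/-- ii) summed: `‖O_Λ‖ ≤ N ō`. [cite: KomaTasaki1993, hypothesis ii)] -/
theorem norm_order_le : ‖sys.order‖ ≤ N * ob :=
  calc ‖sys.order‖ = ‖∑ x, sys.o x‖ := rfl
    _ ≤ ∑ x, ‖sys.o x‖ := norm_sum_le _ _
    _ ≤ ∑ _x : Fin N, ob := sum_le_sum fun x _ => sys.norm_o_le x
    _ = N * ob := by simp

/-- ii) summed: `‖H_Λ‖ ≤ N h̄` (so the spectrum of `H_Λ` lies in `[-h̄N, h̄N]`, KT93 (3.1)).
[cite: KomaTasaki1993, hypothesis ii) and (3.1)] -/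
theorem norm_hamiltonian_le : ‖sys.hamiltonian‖ ≤ N * hb :=
  calc ‖sys.hamiltonian‖ = ‖∑ x, sys.h x‖ := rfl
    _ ≤ ∑ x, ‖sys.h x‖ := norm_sum_le _ _
    _ ≤ ∑ _x : Fin N, hb := sum_le_sum fun x _ => sys.norm_h_le x
    _ = N * hb := by simp

/-- A-priori bound on the order parameter per site: `|m_Λ(B)| ≤ ō` (`|⟨A⟩| ≤ ‖A‖` for a Gibbs state,
`‖O_Λ‖ ≤ Nō`). [cite: KomaTasaki1993, hypothesis ii)] -/
theorem abs_magnetisation_le [Nonempty n] (hob : 0 ≤ ob) (β B : ℝ) :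
    |sys.magnetisation β B| ≤ ob := by
  unfold magnetisation
  rcases Nat.eq_zero_or_pos N with hN | hN
  · simp [hN, hob]
  · have hN' : (0 : ℝ) < N := Nat.cast_pos.mpr hN
    have h1 : |(gibbsState β (sys.fieldHamiltonian B) sys.order).re| ≤ N * ob :=
      (abs_re_gibbsState_le (sys.isHermitian_fieldHamiltonian B) β sys.order).trans sys.norm_order_le
    rw [abs_mul, abs_inv, Nat.abs_cast]
    calc (N : ℝ)⁻¹ * |(gibbsState β (sys.fieldHamiltonian B) sys.order).re|
        ≤ (N : ℝ)⁻¹ * (N * ob) := by gcongr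
      _ = ob := by field_simp

/-- `(O_Λ)^{2k} = ((O_Λ)^k)ᴴ (O_Λ)^k` is positive semidefinite (so the even moments in (2.12)–(2.13)
are non-negative). [cite: KomaTasaki1993, (2.12)–(2.13)] -/
theorem posSemidef_order_pow (k : ℕ) : (sys.order ^ (2 * k)).PosSemidef := by
  have h : sys.order ^ (2 * k) = (sys.order ^ k)ᴴ * sys.order ^ k := by
    rw [(sys.isHermitian_order.pow k).eq, ← pow_add, two_mul]
  rw [h]
  exact posSemidef_conjTranspose_mul_self _

/-- The even moments are non-negative: `0 ≤ N^{-2k}⟨(O_Λ)^{2k}⟩_Λ(0)`.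
[cite: KomaTasaki1993, (2.12)–(2.13)] -/
theorem moment_nonneg [Nonempty n] (β : ℝ) (k : ℕ) : 0 ≤ sys.moment β k := by
  unfold moment
  refine mul_nonneg (inv_nonneg.mpr (pow_nonneg (Nat.cast_nonneg N) _)) ?_
  have h := gibbsState_nonneg_of_posSemidef β sys.isHermitian_hamiltonian
    (sys.posSemidef_order_pow k)
  exact (Complex.nonneg_iff.mp h).1

/-- A-priori bound on the even moments: `N^{-2k}⟨(O_Λ)^{2k}⟩_Λ(0) ≤ ō^{2k}` for `k ≥ 1`.
[cite: KomaTasaki1993, hypothesis ii)] -/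
theorem moment_le [Nonempty n] (hob : 0 ≤ ob) (β : ℝ) {k : ℕ} (hk : 1 ≤ k) :
    sys.moment β k ≤ ob ^ (2 * k) := by
  unfold moment
  have h1 : (gibbsState β sys.hamiltonian (sys.order ^ (2 * k))).re ≤ (N * ob) ^ (2 * k) :=
    calc (gibbsState β sys.hamiltonian (sys.order ^ (2 * k))).re
        ≤ |(gibbsState β sys.hamiltonian (sys.order ^ (2 * k))).re| := le_abs_self _
      _ ≤ ‖sys.order ^ (2 * k)‖ := abs_re_gibbsState_le sys.isHermitian_hamiltonian β _
      _ ≤ ‖sys.order‖ ^ (2 * k) := norm_pow_le' _ (by omega)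
      _ ≤ (N * ob) ^ (2 * k) := pow_le_pow_left₀ (norm_nonneg _) sys.norm_order_le _
  rcases Nat.eq_zero_or_pos N with hN | hN
  · subst hN
    have h0 : ((0 : ℕ) : ℝ) ^ (2 * k) = 0 := by
      rw [Nat.cast_zero]; exact zero_pow (by omega)
    rw [h0, _root_.inv_zero, zero_mul]
    exact pow_nonneg hob _
  · have hN' : (0 : ℝ) < N := Nat.cast_pos.mpr hN
    have hNk : (0 : ℝ) < (N : ℝ) ^ (2 * k) := pow_pos hN' _
    calc ((N : ℝ) ^ (2 * k))⁻¹ * (gibbsState β sys.hamiltonian (sys.order ^ (2 * k))).re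
        ≤ ((N : ℝ) ^ (2 * k))⁻¹ * ((N * ob) ^ (2 * k)) := by gcongr
      _ = ob ^ (2 * k) := by rw [mul_pow, ← mul_assoc, inv_mul_cancel₀ hNk.ne', one_mul]

/-- **KT93 (4.6), the finite-volume concavity step** (PROVED): for `β > 0` and every real `B`,
`f_Λ(0) ≤ f_Λ(B) + B · N⁻¹⟨O_Λ⟩_Λ(B)` — "the concavity of `f(B)` also implies
`f_Λ(0) ≤ f_Λ(B) - B ∂f_Λ(B)/∂B = f_Λ(B) + B N⁻¹⟨O_Λ⟩_Λ(B)`"; here from the Peierls–Bogoliubov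
inequality `log Z(H) - β Re⟨W⟩_H ≤ log Z(H + W)` (tree `log_partitionFn_sub_le_log_partitionFn_add`)
with `H = H_Λ(B)`, `W = B O_Λ`.  Letting `Λ ↑ ℤ^d` (hypothesis i)) and then `B ↓ 0` gives KT93 (4.7)
`m* ≤ m_s`. [cite: KomaTasaki1993, §4 (4.6)–(4.7)] -/
theorem freeEnergy_zero_le [Nonempty n] {β : ℝ} (hβ : 0 < β) (B : ℝ) :
    sys.freeEnergy β 0 ≤ sys.freeEnergy β B + B * sys.magnetisation β B := by
  have key := log_partitionFn_sub_le_log_partitionFn_add (sys.isHermitian_fieldHamiltonian B)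
    (sys.isHermitian_smul_order B) β
  rw [sys.fieldHamiltonian_add_smul B, map_smul, smul_eq_mul, Complex.re_ofReal_mul] at key
  -- `key : log Z_Λ(B) - β (B ⟨O⟩_Λ(B)) ≤ log Z_Λ(0)`
  unfold freeEnergy magnetisation
  rw [sys.fieldHamiltonian_zero]
  set g : ℝ := (gibbsState β (sys.fieldHamiltonian B) sys.order).re with hg
  set LB : ℝ := Real.log (partitionFn β (sys.fieldHamiltonian B)).re with hLB
  set L0 : ℝ := Real.log (partitionFn β sys.hamiltonian).re with hL0
  rcases Nat.eq_zero_or_pos N with hN | hN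
  · simp [hN]
  · have hN' : (0 : ℝ) < N := Nat.cast_pos.mpr hN
    have hβN : 0 < β * N := mul_pos hβ hN'
    have key' : (β * N)⁻¹ * (LB - L0) ≤ (β * N)⁻¹ * (β * (B * g)) :=
      mul_le_mul_of_nonneg_left (by linarith) (inv_nonneg.mpr hβN.le)
    have hsimp : (β * N)⁻¹ * (β * (B * g)) = B * ((N : ℝ)⁻¹ * g) := by
      field_simp
    rw [hsimp] at key'
    have hsplit : (β * ↑N)⁻¹ * (LB - L0) = (β * ↑N)⁻¹ * LB - (β * ↑N)⁻¹ * L0 := by ring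
    linarith

end Z2System

/-! ### KT93 Theorem 2.1 (named fact) -/

/-- **Koma–Tasaki 1993, Theorem 2.1** (the Griffiths–Dyson–Lieb–Simon theorem extended to order
operators that do not commute with the Hamiltonian; NAMED FACT, proof = KT93 §§3–5).  *For an
arbitrary sequence of models satisfying the assumptions i), ii) and iii), we have the inequality*
`m_s ≥ lim_Λ (N^{-2k} ⟨(O_Λ)^{2k}⟩_Λ(0))^{1/(2k)} ≥ σ` (2.13) *for any inverse temperature `β` and
for any positive integer `k`*, where `m_s = lim_{B↓0} lim_Λ N⁻¹⟨O_Λ⟩_Λ(B)` (2.11, volume first)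
and `σ = lim_Λ (N⁻²⟨(O_Λ)²⟩_Λ(0))^{1/2}` (2.12, along a subsequence).  Typed in the form (2.13′)
established by the printed proof (header): a sequence of systems `sys j` (`j : ℕ`) with uniform
constants `h̄ = hb`, `ō = ob`, `r` (ii), iii), (2.3), (2.5) inside `Z2System`), `N j → ∞`, a fixed
`β > 0`, and hypothesis i) — for every real `B` the free energies per site `f_{Λ_j}(B)` converge —
imply: for every `k ≥ 1`, every field `B > 0` and every `ε > 0` there is `j₀` such that for all
`j, j' ≥ j₀`, `(N_{j'}^{-2k} ⟨O^{2k}⟩_{Λ_{j'}}(0))^{1/(2k)} ≤ N_j⁻¹ ⟨O⟩_{Λ_j}(B) + ε`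
(i.e. `limsup_Λ (N^{-2k}⟨O^{2k}⟩_Λ(0))^{1/(2k)} ≤ liminf_Λ N⁻¹⟨O_Λ⟩_Λ(B)` for every `B > 0`; letting
`B ↓ 0` is the printed `m_s ≥ …`; the second printed inequality `… ≥ σ` is Hölder's inequality
`⟨O²⟩^k ≤ ⟨O^{2k}⟩` at finite volume).  Both sides are finite (`Z2System.abs_magnetisation_le`,
`Z2System.moment_le`).  Direction LRO ⟹ response only.
[cite: KomaTasaki1993, Theorem 2.1 (2.13) with §2 i)–iii), (2.3), (2.5), (2.11)–(2.12); proof §§3–5, (4.5)–(4.7), (5.3)] -/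
def kt93_theorem_2_1 : Prop :=
  ∀ (hb ob : ℝ) (r : ℕ) (N : ℕ → ℕ) (n : ℕ → Type v) [∀ j, Fintype (n j)] [∀ j, DecidableEq (n j)]
    [∀ j, Nonempty (n j)] (sys : (j : ℕ) → Z2System (N j) hb ob r (n j)) (β : ℝ),
    0 < β →
    Tendsto N atTop atTop →
    (∀ B : ℝ, ∃ f : ℝ, Tendsto (fun j => (sys j).freeEnergy β B) atTop (𝓝 f)) →
    ∀ k : ℕ, 1 ≤ k → ∀ B : ℝ, 0 < B → ∀ ε : ℝ, 0 < ε →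
      ∃ j₀ : ℕ, ∀ j j' : ℕ, j₀ ≤ j → j₀ ≤ j' →
        ((sys j').moment β k) ^ ((1 : ℝ) / (2 * k)) ≤ (sys j).magnetisation β B + ε

/-! ### KT93 Corollary 2.2: the `SU(2)`-symmetric case (named fact) -/

/-- The Levi-Civita symbol `ε_{jkl}` on `{1,2,3}` (here `Fin 3`, `j ↦ j+1`): `ε = 1` on the cyclic
permutations of `(1,2,3)`, `-1` on the anticyclic ones, `0` if two indices coincide — "where
`ε_{123} = ε_{231} = ε_{312} = -ε_{213} = -ε_{132} = -ε_{321} = 1` and `ε_{jkl} = 0` for other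
`j, k, l`". [cite: KomaTasaki1993, after (2.15)] -/
def leviCivita (j k l : Fin 3) : ℤ :=
  if j = k ∨ k = l ∨ j = l then 0 else if (k : ℕ) = ((j : ℕ) + 1) % 3 then 1 else -1

/-- `ε_{123} = ε_{231} = ε_{312} = 1`, `ε_{213} = ε_{132} = ε_{321} = -1`, `ε_{jjl} = 0`.
[cite: KomaTasaki1993, after (2.15)] -/
theorem leviCivita_values :
    leviCivita 0 1 2 = 1 ∧ leviCivita 1 2 0 = 1 ∧ leviCivita 2 0 1 = 1 ∧
      leviCivita 1 0 2 = -1 ∧ leviCivita 0 2 1 = -1 ∧ leviCivita 2 1 0 = -1 ∧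
      (∀ j l, leviCivita j j l = 0) := by
  refine ⟨by decide, by decide, by decide, by decide, by decide, by decide, fun j l => ?_⟩
  simp [leviCivita]

/-- **KT93 §2, the `SU(2)` data of Corollary 2.2** ((2.14)–(2.17), i)–vi)).  Three-component order
operator densities `o^{(i)}_x` (`o i x`, `i : Fin 3` for KT's `i = 1,2,3`), each self-adjoint with
ii) `‖o^{(i)}_x‖ ≤ ō` and iii) `[h_x, o^{(i)}_y] = 0` unless `y ∈ S^{(i)}(x)`, `|S^{(i)}(x)| ≤ r`
("the above ii) and iii) are valid for each `i`"); iv) `[o^{(i)}_x, o^{(j)}_y] = 0` for `x ≠ y`;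
self-adjoint `su(2)` generators `X^{(1,2,3)}` with (2.15) `[X^{(j)}, X^{(k)}] = i Σ_l ε_{jkl} X^{(l)}`;
v) (2.16) `[X^{(j)}, O^{(k)}] = i Σ_l ε_{jkl} O^{(l)}` for `O^{(k)} = Σ_x o^{(k)}_x`; vi) (2.17)
`[H_Λ, X^{(j)}] = 0`; and the unitary `U_Λ` of (2.3), (2.5) for the component `O^{(1)} = Σ_x o 0 x`
whose magnetisation and long-range order Corollary 2.2 compares (Theorem 6.1 is stated for
`O^{(1)}`).  Compare the tree's `KomaTasaki.SU2Datum` (KT94 ground states, inner-product-space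
vocabulary). [cite: KomaTasaki1993, §2 (2.14)–(2.17), hypotheses i)–vi) (p. 197)] -/
structure SU2System (N : ℕ) (hb ob : ℝ) (r : ℕ) (n : Type v) [Fintype n] [DecidableEq n] where
  /-- local Hamiltonians `h_x` (2.2) -/
  h : Fin N → Matrix n n ℂ
  /-- order-operator densities `o^{(i)}_x` (2.14) -/
  o : Fin 3 → Fin N → Matrix n n ℂ
  /-- the `su(2)` generators `X^{(j)}_Λ` (2.15) -/
  X : Fin 3 → Matrix n n ℂ
  /-- the unitary `U_Λ` of (2.3), (2.5) (for the component `O^{(1)}`) -/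
  U : Matrix n n ℂ
  /-- the support sets `S^{(i)}(x)` of iii) -/
  supp : Fin 3 → Fin N → Finset (Fin N)
  /-- `h_x` self-adjoint -/
  isHermitian_h : ∀ x, (h x).IsHermitian
  /-- `o^{(i)}_x` self-adjoint -/
  isHermitian_o : ∀ i x, (o i x).IsHermitian
  /-- `X^{(j)}` self-adjoint -/
  isHermitian_X : ∀ j, (X j).IsHermitian
  /-- `U_Λ` unitary -/
  U_mul_conjTranspose : U * Uᴴ = 1
  /-- (2.3) `U_Λ H_Λ U_Λ* = H_Λ` -/
  conj_hamiltonian : U * (∑ x, h x) * Uᴴ = ∑ x, h x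
  /-- (2.5) `U_Λ O^{(1)}_Λ U_Λ* = -O^{(1)}_Λ` -/
  conj_order : U * (∑ x, o 0 x) * Uᴴ = -∑ x, o 0 x
  /-- ii) `‖h_x‖ ≤ h̄` -/
  norm_h_le : ∀ x, ‖h x‖ ≤ hb
  /-- ii) for each `i`: `‖o^{(i)}_x‖ ≤ ō` -/
  norm_o_le : ∀ i x, ‖o i x‖ ≤ ob
  /-- iii) for each `i`: `[h_x, o^{(i)}_y] = 0` unless `y ∈ S^{(i)}(x)` -/
  commute_h_o : ∀ i x y, y ∉ supp i x → Commute (h x) (o i y)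
  /-- iii) `|S^{(i)}(x)| ≤ r` -/
  card_supp_le : ∀ i x, (supp i x).card ≤ r
  /-- iii) `r ≥ 2` -/
  two_le_r : 2 ≤ r
  /-- iv) `[o^{(i)}_x, o^{(j)}_y] = 0` for `x ≠ y` -/
  commute_o_o : ∀ i i' x y, x ≠ y → Commute (o i x) (o i' y)
  /-- (2.15) `[X^{(j)}, X^{(k)}] = i Σ_l ε_{jkl} X^{(l)}` -/
  X_comm : ∀ j k, X j * X k - X k * X j = Complex.I • ∑ l, (leviCivita j k l : ℂ) • X l
  /-- v) (2.16) `[X^{(j)}, O^{(k)}] = i Σ_l ε_{jkl} O^{(l)}` -/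
  X_order : ∀ j k, X j * (∑ x, o k x) - (∑ x, o k x) * X j =
    Complex.I • ∑ l, (leviCivita j k l : ℂ) • ∑ x, o l x
  /-- vi) (2.17) `[H_Λ, X^{(j)}] = 0` -/
  commute_hamiltonian_X : ∀ j, Commute (∑ x, h x) (X j)

namespace SU2System

variable {N : ℕ} {hb ob : ℝ} {r : ℕ} {n : Type v} [Fintype n] [DecidableEq n]

/-- The system of the first component `O^{(1)}_Λ = Σ_x o^{(1)}_x` with its sign-flipping unitary:
the `Z2System` to which Theorem 2.1 applies inside Corollary 2.2.
[cite: KomaTasaki1993, Cor 2.2 ("follows from Theorem 2.1 and Theorem 6.1")] -/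
def toZ2System (S : SU2System N hb ob r n) : Z2System N hb ob r n where
  h := S.h
  o := S.o 0
  U := S.U
  supp := S.supp 0
  isHermitian_h := S.isHermitian_h
  isHermitian_o := S.isHermitian_o 0
  U_mul_conjTranspose := S.U_mul_conjTranspose
  conj_hamiltonian := S.conj_hamiltonian
  conj_order := S.conj_order
  norm_h_le := S.norm_h_le
  norm_o_le := S.norm_o_le 0
  commute_h_o := S.commute_h_o 0
  card_supp_le := S.card_supp_le 0
  two_le_r := S.two_le_r

/-- Unfolding: the order operator of `S.toZ2System` is `O^{(1)}_Λ` (the component of (2.14) that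
Theorem 6.1 / Corollary 2.2 speak about). [cite: KomaTasaki1993, (2.14), Cor 2.2] -/
theorem toZ2System_order (S : SU2System N hb ob r n) : S.toZ2System.order = ∑ x, S.o 0 x := rfl

/-- Unfolding: the Hamiltonian of `S.toZ2System` is `H_Λ` (2.2). [cite: KomaTasaki1993, (2.2), Cor 2.2] -/
theorem toZ2System_hamiltonian (S : SU2System N hb ob r n) :
    S.toZ2System.hamiltonian = ∑ x, S.h x := rfl

end SU2System

/-- **Koma–Tasaki 1993, Corollary 2.2** (NAMED FACT; "follows from Theorem 2.1 and Theorem 6.1").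
*For an arbitrary sequence of models satisfying the assumptions i)–vi), we have the inequality*
`m_s ≥ √3 σ` (2.18) *for any inverse temperature `β`* — the magnetisation and long-range order of
one component `O^{(1)}_Λ` under the field `-B O^{(1)}_Λ`; for the Heisenberg antiferromagnet this is
Corollary 1.1 (1.10) ("we believe that the bound (1.10) is saturated"; Remark 4: not provable as an
equality without further assumptions).  Typed like `kt93_theorem_2_1` in the form established by
the proof: for every `B > 0` and `ε > 0`, eventually in `j, j'`,
`√3 · (N_{j'}⁻² ⟨(O^{(1)})²⟩_{Λ_{j'}}(0))^{1/2} ≤ N_j⁻¹ ⟨O^{(1)}⟩_{Λ_j}(B) + ε`.  (KT93 Remark after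
Theorem 6.1: for an `SO(n)` symmetry the factor is `√n`, in particular `√2` for `U(1)` — the electron
pair condensation case; only the printed `SU(2)` statement is typed here.)
[cite: KomaTasaki1993, Corollary 2.2 (2.18) with §2 i)–vi), (2.14)–(2.17); Theorem 6.1 (6.2)] -/
def kt93_corollary_2_2 : Prop :=
  ∀ (hb ob : ℝ) (r : ℕ) (N : ℕ → ℕ) (n : ℕ → Type v) [∀ j, Fintype (n j)] [∀ j, DecidableEq (n j)]
    [∀ j, Nonempty (n j)] (sys : (j : ℕ) → SU2System (N j) hb ob r (n j)) (β : ℝ),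
    0 < β →
    Tendsto N atTop atTop →
    (∀ B : ℝ, ∃ f : ℝ, Tendsto (fun j => (sys j).toZ2System.freeEnergy β B) atTop (𝓝 f)) →
    ∀ B : ℝ, 0 < B → ∀ ε : ℝ, 0 < ε →
      ∃ j₀ : ℕ, ∀ j j' : ℕ, j₀ ≤ j → j₀ ≤ j' →
        Real.sqrt 3 * Real.sqrt ((sys j').toZ2System.moment β 1) ≤
          (sys j).toZ2System.magnetisation β B + ε


/-! ### The second inequality of (2.13): Hölder / Jensen in a Gibbs state (PROVED) -/

section Jensen

variable {n : Type*} [Fintype n] [DecidableEq n]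

/-- **Jensen's (Hölder's) inequality in a Gibbs state** — the second inequality of KT93 (2.13)
("an immediate consequence of the Hölder inequality") at finite volume, in general form: for a
Hermitian Hamiltonian `H`, a positive semidefinite observable `Q` and every `k`,
`(Re ⟨Q⟩_β)^k ≤ Re ⟨Q^k⟩_β`.  Proof: diagonalise `Q = u · diag(λ) · u⋆` (Mathlib
`Matrix.IsHermitian.spectral_theorem`), so `⟨Q^j⟩_β = Σ_i w_i λ_i^j` with the probability weights
`w_i = (u⋆ e^{-βH} u)_{ii} / Z ≥ 0`, `Σ_i w_i = 1`, `λ_i ≥ 0`, and apply the power-mean inequality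
(`Real.pow_arith_mean_le_arith_mean_pow`).  (Vector-state version: the tree's
`KomaTasaki.pow_re_inner_le_re_inner_pow`, KT93 Lemma 7.4.)
[cite: KomaTasaki1993, Theorem 2.1 (2.13), second inequality; Lemma 7.4 (7.15)] -/
theorem pow_re_gibbsState_le_re_gibbsState_pow {H Q : Matrix n n ℂ} (hH : H.IsHermitian)
    (hQ : Q.PosSemidef) [Nonempty n] (β : ℝ) (k : ℕ) :
    (gibbsState β H Q).re ^ k ≤ (gibbsState β H (Q ^ k)).re := by
  set ev : n → ℝ := hQ.1.eigenvalues with hev_def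
  set u := hQ.1.eigenvectorUnitary with hu_def
  set W : Matrix n n ℂ := gibbsWeight β H with hW_def
  set V : Matrix n n ℂ := (star u : Matrix n n ℂ) * W * (u : Matrix n n ℂ) with hV_def
  have hZpos : 0 < (partitionFn β H).re := partitionFn_re_pos hH β
  have hZ : partitionFn β H = ((partitionFn β H).re : ℂ) := partitionFn_eq_re hH β
  -- `Q ^ j = u · diag(λ^j) · u⋆`
  have hQpow : ∀ j : ℕ, Q ^ j =
      (u : Matrix n n ℂ) * diagonal (fun i => ((ev i : ℝ) : ℂ) ^ j) * (star u : Matrix n n ℂ) := by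
    intro j
    have hspec : Q = Unitary.conjStarAlgAut ℂ _ u (diagonal (RCLike.ofReal ∘ ev)) :=
      hQ.1.spectral_theorem
    conv_lhs => rw [hspec]
    rw [← map_pow, diagonal_pow, Unitary.conjStarAlgAut_apply]
    congr 2
  -- `tr (e^{-βH} Q^j) = Σ_i V_ii λ_i^j`
  have htr : ∀ j : ℕ, (W * Q ^ j).trace = ∑ i, V i i * ((ev i : ℝ) : ℂ) ^ j := by
    intro j
    rw [hQpow j, ← Matrix.mul_assoc, ← Matrix.mul_assoc, trace_mul_comm]
    simp only [← Matrix.mul_assoc]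
    rw [← hV_def]
    simp only [trace, diag_apply, mul_diagonal]
  -- the moments as weighted power sums
  have hmom : ∀ j : ℕ, (gibbsState β H (Q ^ j)).re =
      ∑ i, ((partitionFn β H).re⁻¹ * (V i i).re) * ev i ^ j := by
    intro j
    rw [gibbsState_apply, ← hW_def, htr j, hZ, ← Complex.ofReal_inv, Complex.re_ofReal_mul,
      Complex.re_sum, Finset.mul_sum]
    refine Finset.sum_congr rfl fun i _ => ?_
    rw [← Complex.ofReal_pow, Complex.re_mul_ofReal]
    simp only [Complex.ofReal_re]
    ring
  -- the weights are a probability vector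
  have hVpsd : V.PosSemidef := by
    have h := (posDef_gibbsWeight β hH).posSemidef.conjTranspose_mul_mul_same (u : Matrix n n ℂ)
    rw [hV_def, star_eq_conjTranspose]
    exact h
  have hw0 : ∀ i, 0 ≤ (partitionFn β H).re⁻¹ * (V i i).re := fun i =>
    mul_nonneg (inv_nonneg.mpr hZpos.le) (Complex.nonneg_iff.mp (hVpsd.diag_nonneg (i := i))).1
  have hw1 : ∑ i, (partitionFn β H).re⁻¹ * (V i i).re = 1 := by
    rw [← Finset.mul_sum, ← Complex.re_sum]
    have htrV : ∑ i, V i i = V.trace := by simp [trace, diag_apply]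
    have htrW : V.trace = partitionFn β H := by
      rw [hV_def, trace_mul_cycle, ← Unitary.coe_star, Unitary.coe_mul_star_self, Matrix.one_mul,
        hW_def, partitionFn]
    rw [htrV, htrW, inv_mul_cancel₀ hZpos.ne']
  have hev0 : ∀ i, 0 ≤ ev i := fun i => hQ.eigenvalues_nonneg i
  -- Jensen / power means
  have h1 : (gibbsState β H Q).re = ∑ i, ((partitionFn β H).re⁻¹ * (V i i).re) * ev i := by
    have h := hmom 1
    simp only [pow_one] at h
    exact h
  calc (gibbsState β H Q).re ^ k = (∑ i, ((partitionFn β H).re⁻¹ * (V i i).re) * ev i) ^ k := by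
        rw [h1]
    _ ≤ ∑ i, ((partitionFn β H).re⁻¹ * (V i i).re) * ev i ^ k :=
        Real.pow_arith_mean_le_arith_mean_pow univ _ _ (fun i _ => hw0 i) hw1 (fun i _ => hev0 i) k
    _ = (gibbsState β H (Q ^ k)).re := (hmom k).symm

end Jensen

namespace Z2System

variable {N : ℕ} {hb ob : ℝ} {r : ℕ} {n : Type v} [Fintype n] [DecidableEq n]
variable (sys : Z2System N hb ob r n)

/-- **KT93 (2.13), second inequality, at finite volume** (PROVED): the even moments per site are
dominated by powers of the second, `(N⁻² ⟨(O_Λ)²⟩_Λ(0))^k ≤ N^{-2k} ⟨(O_Λ)^{2k}⟩_Λ(0)` for every `k`, i.e.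
`(moment β 1)^{1/2} ≤ (moment β k)^{1/(2k)}`; in the limit `Λ ↑ ℤ^d` this is the printed
`lim_Λ (N^{-2k}⟨O^{2k}⟩_Λ(0))^{1/(2k)} ≥ σ` ("an immediate consequence of the Hölder inequality").
[cite: KomaTasaki1993, Theorem 2.1 (2.13), second inequality] -/
theorem moment_one_pow_le [Nonempty n] (β : ℝ) (k : ℕ) :
    (sys.moment β 1) ^ k ≤ sys.moment β k := by
  have hJ := pow_re_gibbsState_le_re_gibbsState_pow sys.isHermitian_hamiltonian
    (sys.posSemidef_order_pow 1) β k
  rw [← pow_mul] at hJ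
  -- `hJ : (Re⟨O²⟩)^k ≤ Re⟨O^{2k}⟩`
  unfold moment
  simp only [mul_one] at hJ ⊢
  have hN : (((N : ℝ) ^ 2)⁻¹) ^ k = ((N : ℝ) ^ (2 * k))⁻¹ := by rw [inv_pow, ← pow_mul]
  rw [mul_pow, hN]
  exact mul_le_mul_of_nonneg_left hJ (inv_nonneg.mpr (pow_nonneg (Nat.cast_nonneg N) _))

/-- **KT93 (2.13), second inequality, root form** (PROVED): `√(N⁻²⟨(O_Λ)²⟩_Λ(0)) ≤
(N^{-2k}⟨(O_Λ)^{2k}⟩_Λ(0))^{1/(2k)}` for `k ≥ 1` — the finite-volume inequality whose `Λ ↑ ℤ^d`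
limit is `σ ≤ lim_Λ (N^{-2k}⟨O^{2k}⟩_Λ(0))^{1/(2k)}`; combined with `kt93_theorem_2_1` it gives the
printed chain `m_s ≥ … ≥ σ` (and `kt93_corollary_2_2` is the sharper `√3 σ`).
[cite: KomaTasaki1993, Theorem 2.1 (2.13), second inequality, with (2.12)] -/
theorem sqrt_moment_one_le [Nonempty n] (β : ℝ) {k : ℕ} (hk : 1 ≤ k) :
    Real.sqrt (sys.moment β 1) ≤ (sys.moment β k) ^ ((1 : ℝ) / (2 * k)) := by
  have h0 : 0 ≤ sys.moment β 1 := sys.moment_nonneg β 1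
  have hk0 : (0 : ℝ) < 2 * k := by positivity
  have hpow := sys.moment_one_pow_le β k
  -- `√m₁ = (m₁^k)^{1/(2k)} ≤ (m_k)^{1/(2k)}`
  have hsq : Real.sqrt (sys.moment β 1) = ((sys.moment β 1) ^ k) ^ ((1 : ℝ) / (2 * k)) := by
    rw [Real.sqrt_eq_rpow, ← Real.rpow_natCast, ← Real.rpow_mul h0]
    congr 1
    field_simp
  rw [hsq]
  exact Real.rpow_le_rpow (pow_nonneg h0 _) hpow (by positivity)

end Z2System


/-! ### A consumable corollary of Theorem 2.1: no spontaneous magnetisation ⟹ no long-range order -/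

/-- **Corollary of KT93 Theorem 2.1 (PROVED from the named fact): vanishing spontaneous
magnetisation forces vanishing long-range order.**  In the setting of `kt93_theorem_2_1`, if the
order parameter per site under the field is eventually small along the sequence for small fields —
`∀ ε > 0, ∃ B > 0, ∃ j₀, ∀ j ≥ j₀, N_j⁻¹⟨O⟩_{Λ_j}(B) ≤ ε` (e.g. a Mermin–Wagner bound uniform in
the volume) — then `σ = 0` along the whole sequence: `∀ ε > 0, ∃ j₀, ∀ j ≥ j₀,
√(N_j⁻² ⟨(O_{Λ_j})²⟩_{Λ_j}(0)) ≤ ε`.  This is the use of Theorem 2.1 / Corollary 2.2 recorded in the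
docstrings of `HeisenbergOrder.mermin_wagner{,_staggered,_general}` ("`σ ≤ m_s = 0`"): KT93 §1,
"the existence of a long range order in the `SU(2)` invariant state … implies a symmetry breaking",
read contrapositively.
[cite: KomaTasaki1993, Theorem 2.1 (2.13) (contrapositive use, §1 pp. 192–193)] -/
theorem sqrt_moment_eventually_le_of_magnetisation_eventually_le (hthm : kt93_theorem_2_1.{v})
    {hb ob : ℝ} {r : ℕ} {N : ℕ → ℕ} {n : ℕ → Type v} [∀ j, Fintype (n j)]
    [∀ j, DecidableEq (n j)] [∀ j, Nonempty (n j)] (sys : (j : ℕ) → Z2System (N j) hb ob r (n j))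
    {β : ℝ} (hβ : 0 < β) (hN : Tendsto N atTop atTop)
    (hlim : ∀ B : ℝ, ∃ f : ℝ, Tendsto (fun j => (sys j).freeEnergy β B) atTop (𝓝 f))
    (hsmall : ∀ ε : ℝ, 0 < ε → ∃ B : ℝ, 0 < B ∧ ∃ j₀ : ℕ, ∀ j : ℕ, j₀ ≤ j →
      (sys j).magnetisation β B ≤ ε) :
    ∀ ε : ℝ, 0 < ε → ∃ j₀ : ℕ, ∀ j : ℕ, j₀ ≤ j → Real.sqrt ((sys j).moment β 1) ≤ ε := by
  intro ε hε
  obtain ⟨B, hB, j₁, hj₁⟩ := hsmall (ε / 2) (half_pos hε)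
  obtain ⟨j₀, hj₀⟩ := hthm hb ob r N n sys β hβ hN hlim 1 le_rfl B hB (ε / 2) (half_pos hε)
  refine ⟨max j₀ j₁, fun j hj => ?_⟩
  have h1 := hj₀ (max j₀ j₁) j (le_max_left _ _) ((le_max_left _ _).trans hj)
  have h2 := hj₁ (max j₀ j₁) (le_max_right _ _)
  have hsq : Real.sqrt ((sys j).moment β 1) = ((sys j).moment β 1) ^ ((1 : ℝ) / (2 * (1 : ℕ))) := by
    rw [Real.sqrt_eq_rpow]; norm_num
  rw [hsq]
  linarith

end Literature.MathematicalPhysics.QuantumLattice.KomaTasaki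

end
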